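import Summits.Ventures.CertifiedManyBodySolver.Observables.PhaseSeparationExclusionBoxThermalDoccAnchor
import Summits.Ventures.CertifiedManyBodySolver.Observables.PhaseSeparationExclusionBoxGrandCanonicalTcap
import Summits.Ventures.CertifiedManyBodySolver.Observables.PhaseSeparationExclusionBoxGrandCanonicalThermalGap
import Summits.Ventures.CertifiedManyBodySolver.Observables.PhaseSeparationExclusionBoxZeemanTcap
import Summits.Ventures.CertifiedManyBodySolver.Observables.PhaseSeparationExclusionBoxLayeredTcap
import HarnessLib

/-!
# Ventures/CertifiedManyBodySolver — Observables/PhaseSeparationExclusionBoxThermalDoccAnchorAxes.lean: the MOTT (local-moment) anchor of the dense partner on the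
# OTHER `T > 0` axes — `(β, μ)` (no chemical potential carries both phases; certified `μ`-gap), `(β, h)` (Zeeman field) and `(β, t_z)` (interlayer coupling)

HONEST FRAMING: transport device; CONTROL-class competing-order words; conditional on the rows an instance names; nothing about stripes, about which phase is realised, or
about superconductivity; no number of record. Zero compute, no definition, no claim node. Companion of `Observables/PhaseSeparationExclusionBoxThermalDoccAnchor.lean`
(this seat g32: the canonical `T`-axis law with the Mott anchor). The four `T > 0` axis laws of this seat (g26) — `psGCT_not_equilibrium_on_cell_of_columns_hotAnchorSS_tcap`
(no `(β, μ)` carries both phases), `psGCT_gap_on_cell_of_columns_hotAnchorSS_tcap` (certified `μ`-gap at `T > 0`), `psHT_not_fieldEquilibrium_mix_on_cell_of_columns_hotAnchorSS_tcap`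
(Zeeman field `|h| ≤ h₀`), `psLT_not_layeredEquilibrium_mix_on_cell_of_columns_hotAnchorSS_tcap` (interlayer hoppings `(4/π)Σ|t_z| ≤ k`) — take the dense anchor as a cell-uniform
function `Q₂(s)`; here the SAME laws are re-issued with the dense anchor of `doccAnchor_on_cell` (local-moment entropy `log(2+2q) − (n₂ − 2D) log q`, the thermal double occupancy
capped by a LAGGED `T = 0` floor through the `U`-chord): in every anchored inequality `b·Q₂(s) + β_{h,2}·b·L_i(s)` becomes `b·(C₀ + C₁·(L_i(s) − G_i(s)))` (§0
`doccAnchor_chord_slack` = the `U`-chord bookkeeping of the column checks). Everything else — caps, column laws, dilute floors and anchors, the pointwise Literature laws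
(`IsVarEquilibrium.not_isVarEquilibrium_of_le_of_le_hotAnchors_ttPrime` via `psGCT_…_of_fns_hotAnchorFn`, `…sub_mul_field_lt_pressureTT'Zeeman_mix_of_hotAnchors_of_threshold_of_abs_le`,
`…sub_mul_layered_lt_varPressureAt_mix_of_hotAnchors_of_threshold_of_cost_le`) — is untouched.

Cell `pub/hubbard-downfold` (MO-S1 ↔ S2 seam «box ↦ one word»; D-0096 (ii)+(iii), `T × μ / H / c` axes of the D-0098 map), seat `hubbard-downfold-unc-2` (g32).
References: R. B. Israel, *Convexity in the Theory of Lattice Gases* (1979) Lemma II.3.1 / Thm I.2.4 [Israel1979]; E. H. Lieb, CMP 31 (1973) 327 §V [Lieb1973];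
R. B. Griffiths, J. Math. Phys. 5 (1964) 1215 [Griffiths1964]; D. Poulin, M. B. Hastings, PRL 106 (2011) 080403 [PoulinHastings2011]; D. Ruelle, *Statistical Mechanics* (1969)
§3.4 [Ruelle1969].
-/

noncomputable section

namespace Summit.Ventures.CertifiedManyBodySolver.Observables

open Literature.MathematicalPhysics.QuantumLattice Literature.MathematicalPhysics.QuantumLattice.ThermodynamicLimit
open Literature.MathematicalPhysics.QuantumLattice.InfVolFermionState Set Filter
open Literature.Probability.LatticeModels HubbardWave0
open scoped BigOperators

/-! ## §0 `U`-chord bookkeeping of the Mott-anchored column checks -/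

/-- **CHORD SLACK WITH THE MOTT ANCHOR.** At `U ∈ [U₁, U₂]` let `F₂ = ((U₂−U)L₁ + (U−U₁)L₂)/(U₂−U₁)`, `G = ((U₂−U)G₁ + (U−U₁)G₂)/(U₂−U₁)` and `π₂ = C₀ + C₁(F₂ − G) − β_{h,2}F₂`.
If both column margins are `≥ 0` (with an extra cost `k`) and `a π₁ + β_{h,1} a F + b (C₀ + C₁ (L_i − G_i)) < β₀ (a F + b L_i − (c₀ + c₁ U_i) − k)` on both columns, then at `U` the margin is
`≥ 0` and `a π₁ + b π₂ + β_{h,1} a F + β_{h,2} b F₂ < β₀ (a F + b F₂ − (c₀ + c₁ U) − k)`. [cite: Israel1979, Thm. I.2.4] -/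
theorem doccAnchor_chord_slack {U₁ U₂ U a b F L₁ L₂ G₁ G₂ c₀ c₁ k β₀ βh₁ βh₂ π₁ C₀ C₁ : ℝ} (h12 : U₁ < U₂) (hU : U ∈ Icc U₁ U₂)
    (hm₁ : 0 ≤ a * F + b * L₁ - (c₀ + c₁ * U₁) - k) (hm₂ : 0 ≤ a * F + b * L₂ - (c₀ + c₁ * U₂) - k)
    (hg₁ : a * π₁ + βh₁ * (a * F) + b * (C₀ + C₁ * (L₁ - G₁)) < β₀ * (a * F + b * L₁ - (c₀ + c₁ * U₁) - k))
    (hg₂ : a * π₁ + βh₁ * (a * F) + b * (C₀ + C₁ * (L₂ - G₂)) < β₀ * (a * F + b * L₂ - (c₀ + c₁ * U₂) - k)) :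
    0 ≤ a * F + b * (((U₂ - U) * L₁ + (U - U₁) * L₂) / (U₂ - U₁)) - (c₀ + c₁ * U) - k ∧
      a * π₁ + b * (C₀ + C₁ * (((U₂ - U) * L₁ + (U - U₁) * L₂) / (U₂ - U₁) - ((U₂ - U) * G₁ + (U - U₁) * G₂) / (U₂ - U₁)) -
          βh₂ * (((U₂ - U) * L₁ + (U - U₁) * L₂) / (U₂ - U₁))) + βh₁ * (a * F) +
        βh₂ * (b * (((U₂ - U) * L₁ + (U - U₁) * L₂) / (U₂ - U₁))) <
      β₀ * (a * F + b * (((U₂ - U) * L₁ + (U - U₁) * L₂) / (U₂ - U₁)) - (c₀ + c₁ * U) - k) := by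
  have hd : (U₂ - U₁) ≠ 0 := (sub_pos.2 h12).ne'
  constructor
  · have hge := chord_ge_of_ends_ge h12 hU hm₁ hm₂
    have hid : a * F + b * (((U₂ - U) * L₁ + (U - U₁) * L₂) / (U₂ - U₁)) - (c₀ + c₁ * U) - k =
        ((U₂ - U) * (a * F + b * L₁ - (c₀ + c₁ * U₁) - k) + (U - U₁) * (a * F + b * L₂ - (c₀ + c₁ * U₂) - k)) / (U₂ - U₁) := by
      field_simp
      ring
    rw [hid]
    exact hge
  · have e₁ : a * π₁ + βh₁ * (a * F) + b * C₀ < β₀ * (a * F + b * L₁ - (c₀ + c₁ * U₁) - k) - b * (C₁ * (L₁ - G₁)) := by linarith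
    have e₂ : a * π₁ + βh₁ * (a * F) + b * C₀ < β₀ * (a * F + b * L₂ - (c₀ + c₁ * U₂) - k) - b * (C₁ * (L₂ - G₂)) := by linarith
    have hchord := chord_gt_of_ends_gt h12 hU e₁ e₂
    have hid : ((U₂ - U) * (β₀ * (a * F + b * L₁ - (c₀ + c₁ * U₁) - k) - b * (C₁ * (L₁ - G₁))) +
          (U - U₁) * (β₀ * (a * F + b * L₂ - (c₀ + c₁ * U₂) - k) - b * (C₁ * (L₂ - G₂)))) / (U₂ - U₁) =
        β₀ * (a * F + b * (((U₂ - U) * L₁ + (U - U₁) * L₂) / (U₂ - U₁)) - (c₀ + c₁ * U) - k) -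
          b * (C₁ * (((U₂ - U) * L₁ + (U - U₁) * L₂) / (U₂ - U₁) - ((U₂ - U) * G₁ + (U - U₁) * G₂) / (U₂ - U₁))) := by
      field_simp
      ring
    rw [hid] at hchord
    linarith

/-! ## §1 `(β, μ)`: no chemical potential carries both phases; the certified `μ`-gap at `T > 0` -/

/-- **NO `(β, μ)` CARRIES BOTH PHASES, COLUMN × THRESHOLD FORM, MOTT-ANCHORED DENSE PARTNER** (hypotheses exactly as
`psT_not_thermal_mix_on_cell_of_columns_doccAnchor_tcap`, with `0 < n₁`): on `[s₁, s₂] × [U₁, U₂]`, for every `β ≥ β₀` and every `μ`, no variational equilibrium of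
`H(t,s,U) − μN` of density `≥ n₂` coexists with one of density `≤ n₁`. [cite: Israel1979, Thm. I.2.4] [cite: Lieb1973, §V (5.2)–(5.4)] [cite: Ruelle1969, §3.4] -/
theorem psGCT_not_equilibrium_on_cell_of_columns_doccAnchor_tcap (t : ℝ)
    {s₁ s₂ U₁ U₂ Δ n₁ n₂ a b c₀ cs c₁ β β₀ βh₁ βh₂ q C₀ C₁ : ℝ}
    (hΔ : 0 < Δ) (hU₁Δ : 0 ≤ U₁ - Δ) (h12 : U₁ < U₂) (hn₁ : 0 < n₁) (hn : n₁ < n₂) (hn₂ : n₂ < 2) (ha : 0 ≤ a) (hb : 0 ≤ b)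
    (hab : a + b = 1) (hβh₁ : 0 ≤ βh₁) (h0₁ : βh₁ ≤ β₀) (hq : 1 < q)
    (hC₀ : Real.log (2 + 2 * q) - Real.log q * n₂ ≤ C₀) (hC₁ : 2 * Real.log q / Δ ≤ C₁) (hβh₂ : C₁ ≤ βh₂) (h0₂ : βh₂ ≤ β₀)
    (hβ₀ : β₀ ≤ β) (hβ₀pos : 0 < β₀) {L₁ L₂ G₁ G₂ F₁ Q₁ : ℝ → ℝ}
    (hC : ∀ s ∈ Icc s₁ s₂, ∀ U ∈ Icc U₁ U₂, energyDensityTT' t s U (a * n₁ + b * n₂) ≤ c₀ + cs * s + c₁ * U)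
    (hL₁ : ∀ s ∈ Icc s₁ s₂, L₁ s ≤ energyDensityTT' t s U₁ n₂) (hL₂ : ∀ s ∈ Icc s₁ s₂, L₂ s ≤ energyDensityTT' t s U₂ n₂)
    (hG₁ : ∀ s ∈ Icc s₁ s₂, G₁ s ≤ energyDensityTT' t s (U₁ - Δ) n₂) (hG₂ : ∀ s ∈ Icc s₁ s₂, G₂ s ≤ energyDensityTT' t s (U₂ - Δ) n₂)
    (hLG₁ : ∀ s ∈ Icc s₁ s₂, G₁ s ≤ L₁ s) (hLG₂ : ∀ s ∈ Icc s₁ s₂, G₂ s ≤ L₂ s)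
    (hF₁ : ∀ s ∈ Icc s₁ s₂, ∀ U ∈ Icc U₁ U₂, F₁ s ≤ energyDensityTT' t s U n₁)
    (hπ₁ : ∀ s ∈ Icc s₁ s₂, ∀ U ∈ Icc U₁ U₂, pressureTT' βh₁ t s U n₁ ≤ Q₁ s)
    (hm₁ : ∀ s ∈ Icc s₁ s₂, 0 ≤ a * F₁ s + b * L₁ s - (c₀ + cs * s + c₁ * U₁))
    (hm₂ : ∀ s ∈ Icc s₁ s₂, 0 ≤ a * F₁ s + b * L₂ s - (c₀ + cs * s + c₁ * U₂))
    (hg₁ : ∀ s ∈ Icc s₁ s₂,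
      a * Q₁ s + βh₁ * (a * F₁ s) + b * (C₀ + C₁ * (L₁ s - G₁ s)) < β₀ * (a * F₁ s + b * L₁ s - (c₀ + cs * s + c₁ * U₁)))
    (hg₂ : ∀ s ∈ Icc s₁ s₂,
      a * Q₁ s + βh₁ * (a * F₁ s) + b * (C₀ + C₁ * (L₂ s - G₂ s)) < β₀ * (a * F₁ s + b * L₂ s - (c₀ + cs * s + c₁ * U₂)))
    {s : ℝ} (hs : s ∈ Icc s₁ s₂) {U : ℝ} (hU : U ∈ Icc U₁ U₂)
    {Γ : FermionInteraction 2} {R' μ : ℝ} {ω₁ ω₂ : InfVolFermionState 2} (hω₁ : ω₁.IsVarEquilibrium β Γ R')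
    (hΓ : ∀ σ : InfVolFermionState 2, σ.meanEnergy Γ R' = σ.meanEnergy (hubbardTTPrimeFermionInteraction t s U) 1 - μ * σ.density)
    (hρ₁ : ω₁.density ≤ n₁) (hρ₂ : n₂ ≤ ω₂.density) :
    ¬ ω₂.IsVarEquilibrium β Γ R' := by
  have hn2' : 0 < n₂ := hn₁.trans hn
  have hU₁ : 0 ≤ U₁ := hU₁Δ.trans (by linarith)
  have hβpos : 0 < β := hβ₀pos.trans_le hβ₀
  have hκ : 0 < Real.log q := Real.log_pos hq
  have hC₁pos : 0 < C₁ := lt_of_lt_of_le (div_pos (by linarith) hΔ) hC₁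
  have hβh₂' : 0 ≤ βh₂ := hC₁pos.le.trans hβh₂
  refine psGCT_not_equilibrium_on_cell_of_fns_hotAnchorFn t hU₁ hβpos hn₁ hn hn₂ ha hb hab hβh₁ hβh₂' (h0₁.trans hβ₀)
    (h0₂.trans hβ₀) (C := fun s U => c₀ + cs * s + c₁ * U) (F₁ := fun s _ => F₁ s)
    (F₂ := fun s U => ((U₂ - U) * L₁ s + (U - U₁) * L₂ s) / (U₂ - U₁)) (P₁ := fun s _ => Q₁ s)
    (P₂ := fun s U => C₀ + C₁ * (((U₂ - U) * L₁ s + (U - U₁) * L₂ s) / (U₂ - U₁) - ((U₂ - U) * G₁ s + (U - U₁) * G₂ s) / (U₂ - U₁)) -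
      βh₂ * (((U₂ - U) * L₁ s + (U - U₁) * L₂ s) / (U₂ - U₁)))
    hC hF₁ (floor_on_cell_of_columnLaws t hn2'.le hn₂ hU₁ h12 hL₁ hL₂) hπ₁
    (doccAnchor_on_cell t hΔ hU₁Δ h12 hn2' hn₂ hq hC₀ hC₁ hβh₂ hL₁ hL₂ hG₁ hG₂ hLG₁ hLG₂) ?_ hs hU hω₁ hΓ hρ₁ hρ₂
  intro s hs U hU
  obtain ⟨hMnn, hM₀⟩ := doccAnchor_chord_slack (a := a) (b := b) (F := F₁ s) (L₁ := L₁ s) (L₂ := L₂ s) (c₀ := c₀ + cs * s) (c₁ := c₁) (k := 0) (β₀ := β₀)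
    (βh₁ := βh₁) (βh₂ := βh₂) (π₁ := Q₁ s) (C₀ := C₀) (C₁ := C₁) (G₁ := G₁ s) (G₂ := G₂ s) h12 hU
    (by have := hm₁ s hs; linarith) (by have := hm₂ s hs; linarith) (by have := hg₁ s hs; linarith) (by have := hg₂ s hs; linarith)
  have k := mul_le_mul_of_nonneg_right hβ₀ (by linarith [hMnn] :
    (0 : ℝ) ≤ a * F₁ s + b * (((U₂ - U) * L₁ s + (U - U₁) * L₂ s) / (U₂ - U₁)) - (c₀ + cs * s + c₁ * U))
  show a * Q₁ s + b * (C₀ + C₁ * (((U₂ - U) * L₁ s + (U - U₁) * L₂ s) / (U₂ - U₁) -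
      ((U₂ - U) * G₁ s + (U - U₁) * G₂ s) / (U₂ - U₁)) - βh₂ * (((U₂ - U) * L₁ s + (U - U₁) * L₂ s) / (U₂ - U₁))) +
      βh₁ * (a * F₁ s) + βh₂ * (b * (((U₂ - U) * L₁ s + (U - U₁) * L₂ s) / (U₂ - U₁))) <
    β * (a * F₁ s + b * (((U₂ - U) * L₁ s + (U - U₁) * L₂ s) / (U₂ - U₁)) - (c₀ + cs * s + c₁ * U))
  linarith

/-- **CELL-UNIFORM `T > 0` `μ`-GAP, COLUMN × THRESHOLD FORM, MOTT-ANCHORED DENSE PARTNER**: both column margins `≥ g` and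
`a Q₁(s) + β_{h,1} a F₁(s) + b (C₀ + C₁ (L_i(s) − G_i(s))) ≤ β₀·(a F₁(s) + b L_i(s) − (c₀ + c_s s + c₁U_i) − g)` on both columns; then on `[s₁, s₂] × [U₁, U₂]`, for every
`β ≥ β₀`: `a·b·(n₂ − n₁)·(μ₂ − μ₁) ≥ g`. [cite: Israel1979, Thm. I.2.4] [cite: Ruelle1969, §3.4] [cite: Lieb1973, §V (5.2)–(5.4)] -/
theorem psGCT_gap_on_cell_of_columns_doccAnchor_tcap (t : ℝ)
    {s₁ s₂ U₁ U₂ Δ n₁ n₂ a b c₀ cs c₁ β₀ βh₁ βh₂ q C₀ C₁ g : ℝ}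
    (hΔ : 0 < Δ) (hU₁Δ : 0 ≤ U₁ - Δ) (h12 : U₁ < U₂) (hn₁ : 0 < n₁) (hn : n₁ < n₂) (hn₂ : n₂ < 2) (ha : 0 ≤ a) (hb : 0 ≤ b)
    (hab : a + b = 1) (hβh₁ : 0 ≤ βh₁) (h0₁ : βh₁ ≤ β₀) (hq : 1 < q)
    (hC₀ : Real.log (2 + 2 * q) - Real.log q * n₂ ≤ C₀) (hC₁ : 2 * Real.log q / Δ ≤ C₁) (hβh₂ : C₁ ≤ βh₂) (h0₂ : βh₂ ≤ β₀)
    (hβ₀pos : 0 < β₀) {L₁ L₂ G₁ G₂ F₁ Q₁ : ℝ → ℝ}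
    (hC : ∀ s ∈ Icc s₁ s₂, ∀ U ∈ Icc U₁ U₂, energyDensityTT' t s U (a * n₁ + b * n₂) ≤ c₀ + cs * s + c₁ * U)
    (hL₁ : ∀ s ∈ Icc s₁ s₂, L₁ s ≤ energyDensityTT' t s U₁ n₂) (hL₂ : ∀ s ∈ Icc s₁ s₂, L₂ s ≤ energyDensityTT' t s U₂ n₂)
    (hG₁ : ∀ s ∈ Icc s₁ s₂, G₁ s ≤ energyDensityTT' t s (U₁ - Δ) n₂) (hG₂ : ∀ s ∈ Icc s₁ s₂, G₂ s ≤ energyDensityTT' t s (U₂ - Δ) n₂)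
    (hLG₁ : ∀ s ∈ Icc s₁ s₂, G₁ s ≤ L₁ s) (hLG₂ : ∀ s ∈ Icc s₁ s₂, G₂ s ≤ L₂ s)
    (hF₁ : ∀ s ∈ Icc s₁ s₂, ∀ U ∈ Icc U₁ U₂, F₁ s ≤ energyDensityTT' t s U n₁)
    (hπ₁ : ∀ s ∈ Icc s₁ s₂, ∀ U ∈ Icc U₁ U₂, pressureTT' βh₁ t s U n₁ ≤ Q₁ s)
    (hgm₁ : ∀ s ∈ Icc s₁ s₂, g ≤ a * F₁ s + b * L₁ s - (c₀ + cs * s + c₁ * U₁))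
    (hgm₂ : ∀ s ∈ Icc s₁ s₂, g ≤ a * F₁ s + b * L₂ s - (c₀ + cs * s + c₁ * U₂))
    (hN₁ : ∀ s ∈ Icc s₁ s₂,
      a * Q₁ s + βh₁ * (a * F₁ s) + b * (C₀ + C₁ * (L₁ s - G₁ s)) < β₀ * (a * F₁ s + b * L₁ s - (c₀ + cs * s + c₁ * U₁) - g))
    (hN₂ : ∀ s ∈ Icc s₁ s₂,
      a * Q₁ s + βh₁ * (a * F₁ s) + b * (C₀ + C₁ * (L₂ s - G₂ s)) < β₀ * (a * F₁ s + b * L₂ s - (c₀ + cs * s + c₁ * U₂) - g))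
    {s : ℝ} (hs : s ∈ Icc s₁ s₂) {U : ℝ} (hU : U ∈ Icc U₁ U₂) {β : ℝ} (hβ : β₀ ≤ β)
    {Γ₁ Γ₂ : FermionInteraction 2} {R₁ R₂ μ₁ μ₂ : ℝ} {ω₁ ω₂ : InfVolFermionState 2}
    (hω₁ : ω₁.IsVarEquilibrium β Γ₁ R₁)
    (hΓ₁ : ∀ σ : InfVolFermionState 2, σ.meanEnergy Γ₁ R₁ = σ.meanEnergy (hubbardTTPrimeFermionInteraction t s U) 1 - μ₁ * σ.density)
    (hω₂ : ω₂.IsVarEquilibrium β Γ₂ R₂)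
    (hΓ₂ : ∀ σ : InfVolFermionState 2, σ.meanEnergy Γ₂ R₂ = σ.meanEnergy (hubbardTTPrimeFermionInteraction t s U) 1 - μ₂ * σ.density)
    (hρ₁ : ω₁.density ≤ n₁) (hρ₂ : n₂ ≤ ω₂.density) :
    g ≤ a * b * (n₂ - n₁) * (μ₂ - μ₁) := by
  have hn2' : 0 < n₂ := hn₁.trans hn
  have hU₁ : 0 ≤ U₁ := hU₁Δ.trans (by linarith)
  have hκ : 0 < Real.log q := Real.log_pos hq
  have hC₁pos : 0 < C₁ := lt_of_lt_of_le (div_pos (by linarith) hΔ) hC₁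
  have hβh₂' : 0 ≤ βh₂ := hC₁pos.le.trans hβh₂
  refine psGCT_gap_on_cell_of_fns_hotAnchorFn t hU₁ hβ₀pos hn₁ hn hn₂ ha hb hab hβh₁ hβh₂' h0₁ h0₂
    (C := fun s U => c₀ + cs * s + c₁ * U) (F₁ := fun s _ => F₁ s)
    (F₂ := fun s U => ((U₂ - U) * L₁ s + (U - U₁) * L₂ s) / (U₂ - U₁)) (P₁ := fun s _ => Q₁ s)
    (P₂ := fun s U => C₀ + C₁ * (((U₂ - U) * L₁ s + (U - U₁) * L₂ s) / (U₂ - U₁) - ((U₂ - U) * G₁ s + (U - U₁) * G₂ s) / (U₂ - U₁)) -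
      βh₂ * (((U₂ - U) * L₁ s + (U - U₁) * L₂ s) / (U₂ - U₁)))
    hC hF₁ (floor_on_cell_of_columnLaws t hn2'.le hn₂ hU₁ h12 hL₁ hL₂) hπ₁
    (doccAnchor_on_cell t hΔ hU₁Δ h12 hn2' hn₂ hq hC₀ hC₁ hβh₂ hL₁ hL₂ hG₁ hG₂ hLG₁ hLG₂) ?_ ?_ hs hU hβ hω₁ hΓ₁ hω₂ hΓ₂ hρ₁ hρ₂
  · intro s hs U hU
    obtain ⟨hMnn, -⟩ := doccAnchor_chord_slack (a := a) (b := b) (F := F₁ s) (L₁ := L₁ s) (L₂ := L₂ s) (c₀ := c₀ + cs * s) (c₁ := c₁) (k := g) (β₀ := β₀)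
      (βh₁ := βh₁) (βh₂ := βh₂) (π₁ := Q₁ s) (C₀ := C₀) (C₁ := C₁) (G₁ := G₁ s) (G₂ := G₂ s) h12 hU
      (by have := hgm₁ s hs; linarith) (by have := hgm₂ s hs; linarith) (by have := hN₁ s hs; linarith) (by have := hN₂ s hs; linarith)
    show g ≤ a * F₁ s + b * (((U₂ - U) * L₁ s + (U - U₁) * L₂ s) / (U₂ - U₁)) - (c₀ + cs * s + c₁ * U)
    linarith
  · intro s hs U hU
    obtain ⟨-, hM₀⟩ := doccAnchor_chord_slack (a := a) (b := b) (F := F₁ s) (L₁ := L₁ s) (L₂ := L₂ s) (c₀ := c₀ + cs * s) (c₁ := c₁) (k := g) (β₀ := β₀)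
      (βh₁ := βh₁) (βh₂ := βh₂) (π₁ := Q₁ s) (C₀ := C₀) (C₁ := C₁) (G₁ := G₁ s) (G₂ := G₂ s) h12 hU
      (by have := hgm₁ s hs; linarith) (by have := hgm₂ s hs; linarith) (by have := hN₁ s hs; linarith) (by have := hN₂ s hs; linarith)
    show a * Q₁ s + b * (C₀ + C₁ * (((U₂ - U) * L₁ s + (U - U₁) * L₂ s) / (U₂ - U₁) -
        ((U₂ - U) * G₁ s + (U - U₁) * G₂ s) / (U₂ - U₁)) - βh₂ * (((U₂ - U) * L₁ s + (U - U₁) * L₂ s) / (U₂ - U₁))) +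
        βh₁ * (a * F₁ s) + βh₂ * (b * (((U₂ - U) * L₁ s + (U - U₁) * L₂ s) / (U₂ - U₁))) ≤
      β₀ * (a * F₁ s + b * (((U₂ - U) * L₁ s + (U - U₁) * L₂ s) / (U₂ - U₁)) - (c₀ + cs * s + c₁ * U) - g)
    linarith

/-! ## §2 `(β, h)`: Zeeman field -/

/-- **`T > 0`, ZEEMAN FIELD `|h| ≤ h₀`, COLUMN × THRESHOLD FORM, MOTT-ANCHORED DENSE PARTNER** (`n₂ ≤ 1`; hypotheses as
`psHT_not_fieldEquilibrium_mix_on_cell_of_columns_hotAnchorSS_tcap` with the Mott dense anchor): both column margins `≥ h₀(a n₁ + b n₂)` and the Mott-anchored inequalities with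
that cost on both columns ⇒ on the cell, for every `β ≥ β₀` and `|h| ≤ h₀`, the `(≤ n₁ ∣ ≥ n₂)` mixture is not a thermal equilibrium state in the field.
[cite: Israel1979, Thm. I.2.4] [cite: Griffiths1964] [cite: Lieb1973, §V (5.2)–(5.4)] -/
theorem psHT_not_fieldEquilibrium_mix_on_cell_of_columns_doccAnchor_tcap (t : ℝ)
    {s₁ s₂ U₁ U₂ Δ n₁ n₂ a b c₀ cs c₁ β β₀ βh₁ βh₂ q C₀ C₁ h₀ hz : ℝ}
    (hΔ : 0 < Δ) (hU₁Δ : 0 ≤ U₁ - Δ) (h12 : U₁ < U₂) (hn₁ : 0 ≤ n₁) (hn : n₁ < n₂) (hn₂ : n₂ ≤ 1) (ha : 0 ≤ a) (hb : 0 ≤ b)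
    (hab : a + b = 1) (hβh₁ : 0 ≤ βh₁) (h0₁ : βh₁ ≤ β₀) (hq : 1 < q)
    (hC₀ : Real.log (2 + 2 * q) - Real.log q * n₂ ≤ C₀) (hC₁ : 2 * Real.log q / Δ ≤ C₁) (hβh₂ : C₁ ≤ βh₂) (h0₂ : βh₂ ≤ β₀)
    (hβ₀ : β₀ ≤ β) (hβ₀pos : 0 < β₀) {L₁ L₂ G₁ G₂ F₁ Q₁ : ℝ → ℝ}
    (hC : ∀ s ∈ Icc s₁ s₂, ∀ U ∈ Icc U₁ U₂, energyDensityTT' t s U (a * n₁ + b * n₂) ≤ c₀ + cs * s + c₁ * U)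
    (hL₁ : ∀ s ∈ Icc s₁ s₂, L₁ s ≤ energyDensityTT' t s U₁ n₂) (hL₂ : ∀ s ∈ Icc s₁ s₂, L₂ s ≤ energyDensityTT' t s U₂ n₂)
    (hG₁ : ∀ s ∈ Icc s₁ s₂, G₁ s ≤ energyDensityTT' t s (U₁ - Δ) n₂) (hG₂ : ∀ s ∈ Icc s₁ s₂, G₂ s ≤ energyDensityTT' t s (U₂ - Δ) n₂)
    (hLG₁ : ∀ s ∈ Icc s₁ s₂, G₁ s ≤ L₁ s) (hLG₂ : ∀ s ∈ Icc s₁ s₂, G₂ s ≤ L₂ s)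
    (hF₁ : ∀ s ∈ Icc s₁ s₂, ∀ U ∈ Icc U₁ U₂, F₁ s ≤ energyDensityTT' t s U n₁)
    (hπ₁ : ∀ s ∈ Icc s₁ s₂, ∀ U ∈ Icc U₁ U₂, pressureTT' βh₁ t s U n₁ ≤ Q₁ s)
    (hh : |hz| ≤ h₀)
    (hm₁ : ∀ s ∈ Icc s₁ s₂, 0 ≤ a * F₁ s + b * L₁ s - (c₀ + cs * s + c₁ * U₁) - h₀ * (a * n₁ + b * n₂))
    (hm₂ : ∀ s ∈ Icc s₁ s₂, 0 ≤ a * F₁ s + b * L₂ s - (c₀ + cs * s + c₁ * U₂) - h₀ * (a * n₁ + b * n₂))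
    (hg₁ : ∀ s ∈ Icc s₁ s₂, a * Q₁ s + βh₁ * (a * F₁ s) + b * (C₀ + C₁ * (L₁ s - G₁ s)) <
      β₀ * (a * F₁ s + b * L₁ s - (c₀ + cs * s + c₁ * U₁) - h₀ * (a * n₁ + b * n₂)))
    (hg₂ : ∀ s ∈ Icc s₁ s₂, a * Q₁ s + βh₁ * (a * F₁ s) + b * (C₀ + C₁ * (L₂ s - G₂ s)) <
      β₀ * (a * F₁ s + b * L₂ s - (c₀ + cs * s + c₁ * U₂) - h₀ * (a * n₁ + b * n₂)))
    {s : ℝ} (hs : s ∈ Icc s₁ s₂) {U : ℝ} (hU : U ∈ Icc U₁ U₂)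
    {ω₁ ω₂ : InfVolFermionState 2} (h₁ : ω₁.IsTranslationInvariant) (h₂ : ω₂.IsTranslationInvariant)
    (hρ₁ : 0 < ω₁.density) (hρ₁' : ω₁.density ≤ n₁) (hρ₂ : n₂ ≤ ω₂.density) (hρ₂' : ω₂.density < 2)
    {lam : ℝ} (hl0 : 0 < lam) (hl1 : lam < 1) :
    (mix lam hl0.le hl1.le ω₁ ω₂).entropyDensitySup -
        β * (mix lam hl0.le hl1.le ω₁ ω₂).meanEnergy (gcInteractionTT' t s U 0 hz) 1 <
      pressureTT'Zeeman β t s U (mix lam hl0.le hl1.le ω₁ ω₂).density hz := by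
  have hn2' : 0 < n₂ := hn₁.trans_lt hn
  have hn₂2 : n₂ < 2 := by linarith
  have hU₁ : 0 ≤ U₁ := hU₁Δ.trans (by linarith)
  have hβpos : 0 < β := hβ₀pos.trans_le hβ₀
  have hκ : 0 < Real.log q := Real.log_pos hq
  have hC₁pos : 0 < C₁ := lt_of_lt_of_le (div_pos (by linarith) hΔ) hC₁
  have hβh₂' : 0 ≤ βh₂ := hC₁pos.le.trans hβh₂
  have hF₂ := floor_on_cell_of_columnLaws t hn2'.le hn₂2 hU₁ h12 hL₁ hL₂ s hs U hU
  have hπ₂ := doccAnchor_on_cell t hΔ hU₁Δ h12 hn2' hn₂2 hq hC₀ hC₁ hβh₂ hL₁ hL₂ hG₁ hG₂ hLG₁ hLG₂ s hs U hU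
  obtain ⟨hMnn, hM₀⟩ := doccAnchor_chord_slack (c₀ := c₀ + cs * s) (k := h₀ * (a * n₁ + b * n₂)) (βh₁ := βh₁) (βh₂ := βh₂) (π₁ := Q₁ s)
    (C₀ := C₀) (C₁ := C₁) (G₁ := G₁ s) (G₂ := G₂ s) h12 hU (hm₁ s hs) (hm₂ s hs) (hg₁ s hs) (hg₂ s hs)
  exact h₁.sub_mul_field_lt_pressureTT'Zeeman_mix_of_hotAnchors_of_threshold_of_abs_le t s (hU₁.trans hU.1) hβpos hz h₂ hρ₁
    hρ₂' hρ₁' hn hρ₂ hn₂ ha hb hab (hC s hs U hU) (hF₁ s hs U hU) hF₂ hβh₁ hβh₂' h0₁ h0₂ hβ₀ (hπ₁ s hs U hU) hπ₂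
    hh (by linarith [hMnn]) (by linarith [hM₀]) hl0 hl1

/-! ## §3 `(β, t_z)`: interlayer coupling -/

/-- **`T > 0`, INTERLAYER HOPPINGS `(4/π)Σ|t_z| ≤ k`, COLUMN × THRESHOLD FORM, MOTT-ANCHORED DENSE PARTNER** (hypotheses as
`psLT_not_layeredEquilibrium_mix_on_cell_of_columns_hotAnchorSS_tcap` with the Mott dense anchor): both column margins `≥ k` and the Mott-anchored inequalities with cost `k` on
both columns ⇒ on the cell, for every `β ≥ β₀`, no layered thermal equilibrium state of `ℤ³` is the `(≤ n₁ ∣ ≥ n₂)` mixture.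
[cite: Israel1979, Thm. I.2.4] [cite: Lieb1973, §V (5.2)–(5.4)] [cite: Ruelle1969, §3.4] -/
theorem psLT_not_layeredEquilibrium_mix_on_cell_of_columns_doccAnchor_tcap (t : ℝ) {κ : Type*} [Fintype κ] {w : κ → Site 3}
    (hw : ∀ b, w b 0 ≠ 0) (tz : κ → ℝ) {R' : ℝ} (hR' : 1 ≤ R') (hwR' : ∀ b, w b ∈ thicken ({0} : Finset (Site 3)) R')
    {s₁ s₂ U₁ U₂ Δ n₁ n₂ a b c₀ cs c₁ β β₀ βh₁ βh₂ q C₀ C₁ k : ℝ}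
    (hΔ : 0 < Δ) (hU₁Δ : 0 ≤ U₁ - Δ) (h12 : U₁ < U₂) (hn₁ : 0 ≤ n₁) (hn : n₁ < n₂) (hn₂ : n₂ < 2) (ha : 0 ≤ a) (hb : 0 ≤ b)
    (hab : a + b = 1) (hβh₁ : 0 ≤ βh₁) (h0₁ : βh₁ ≤ β₀) (hq : 1 < q)
    (hC₀ : Real.log (2 + 2 * q) - Real.log q * n₂ ≤ C₀) (hC₁ : 2 * Real.log q / Δ ≤ C₁) (hβh₂ : C₁ ≤ βh₂) (h0₂ : βh₂ ≤ β₀)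
    (hβ₀ : β₀ ≤ β) (hβ₀pos : 0 < β₀) {L₁ L₂ G₁ G₂ F₁ Q₁ : ℝ → ℝ}
    (hC : ∀ s ∈ Icc s₁ s₂, ∀ U ∈ Icc U₁ U₂, energyDensityTT' t s U (a * n₁ + b * n₂) ≤ c₀ + cs * s + c₁ * U)
    (hL₁ : ∀ s ∈ Icc s₁ s₂, L₁ s ≤ energyDensityTT' t s U₁ n₂) (hL₂ : ∀ s ∈ Icc s₁ s₂, L₂ s ≤ energyDensityTT' t s U₂ n₂)
    (hG₁ : ∀ s ∈ Icc s₁ s₂, G₁ s ≤ energyDensityTT' t s (U₁ - Δ) n₂) (hG₂ : ∀ s ∈ Icc s₁ s₂, G₂ s ≤ energyDensityTT' t s (U₂ - Δ) n₂)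
    (hLG₁ : ∀ s ∈ Icc s₁ s₂, G₁ s ≤ L₁ s) (hLG₂ : ∀ s ∈ Icc s₁ s₂, G₂ s ≤ L₂ s)
    (hF₁ : ∀ s ∈ Icc s₁ s₂, ∀ U ∈ Icc U₁ U₂, F₁ s ≤ energyDensityTT' t s U n₁)
    (hπ₁ : ∀ s ∈ Icc s₁ s₂, ∀ U ∈ Icc U₁ U₂, pressureTT' βh₁ t s U n₁ ≤ Q₁ s)
    (hk : 4 / Real.pi * ∑ b, |tz b| ≤ k)
    (hm₁ : ∀ s ∈ Icc s₁ s₂, 0 ≤ a * F₁ s + b * L₁ s - (c₀ + cs * s + c₁ * U₁) - k)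
    (hm₂ : ∀ s ∈ Icc s₁ s₂, 0 ≤ a * F₁ s + b * L₂ s - (c₀ + cs * s + c₁ * U₂) - k)
    (hg₁ : ∀ s ∈ Icc s₁ s₂, a * Q₁ s + βh₁ * (a * F₁ s) + b * (C₀ + C₁ * (L₁ s - G₁ s)) <
      β₀ * (a * F₁ s + b * L₁ s - (c₀ + cs * s + c₁ * U₁) - k))
    (hg₂ : ∀ s ∈ Icc s₁ s₂, a * Q₁ s + βh₁ * (a * F₁ s) + b * (C₀ + C₁ * (L₂ s - G₂ s)) <
      β₀ * (a * F₁ s + b * L₂ s - (c₀ + cs * s + c₁ * U₂) - k))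
    {s : ℝ} (hs : s ∈ Icc s₁ s₂) {U : ℝ} (hU : U ∈ Icc U₁ U₂)
    {ω₁ ω₂ : InfVolFermionState 3} (h₁ : ω₁.IsTranslationInvariant) (h₂ : ω₂.IsTranslationInvariant)
    (hρ₁ : 0 < ω₁.density) (hρ₁' : ω₁.density ≤ n₁) (hρ₂ : n₂ ≤ ω₂.density) (hρ₂' : ω₂.density < 2)
    {lam : ℝ} (hl0 : 0 < lam) (hl1 : lam < 1) :
    (mix lam hl0.le hl1.le ω₁ ω₂).entropyDensitySup -
        β * (mix lam hl0.le hl1.le ω₁ ω₂).meanEnergy (layeredHubbardTTPrime t s U w tz) R' <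
      (layeredHubbardTTPrime t s U w tz).varPressureAt β R' (mix lam hl0.le hl1.le ω₁ ω₂).density := by
  have hn2' : 0 < n₂ := hn₁.trans_lt hn
  have hU₁ : 0 ≤ U₁ := hU₁Δ.trans (by linarith)
  have hβpos : 0 < β := hβ₀pos.trans_le hβ₀
  have hκ : 0 < Real.log q := Real.log_pos hq
  have hC₁pos : 0 < C₁ := lt_of_lt_of_le (div_pos (by linarith) hΔ) hC₁
  have hβh₂' : 0 ≤ βh₂ := hC₁pos.le.trans hβh₂
  have hF₂ := floor_on_cell_of_columnLaws t hn2'.le hn₂ hU₁ h12 hL₁ hL₂ s hs U hU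
  have hπ₂ := doccAnchor_on_cell t hΔ hU₁Δ h12 hn2' hn₂ hq hC₀ hC₁ hβh₂ hL₁ hL₂ hG₁ hG₂ hLG₁ hLG₂ s hs U hU
  obtain ⟨hMnn, hM₀⟩ := doccAnchor_chord_slack (c₀ := c₀ + cs * s) (k := k) (βh₁ := βh₁) (βh₂ := βh₂) (π₁ := Q₁ s)
    (C₀ := C₀) (C₁ := C₁) (G₁ := G₁ s) (G₂ := G₂ s) h12 hU (hm₁ s hs) (hm₂ s hs) (hg₁ s hs) (hg₂ s hs)
  exact h₁.sub_mul_layered_lt_varPressureAt_mix_of_hotAnchors_of_threshold_of_cost_le t s (hU₁.trans hU.1) hβpos hw tz hR' hwR'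
    h₂ hρ₁ hρ₂' hρ₁' hn hρ₂ ha hb hab (hC s hs U hU) (hF₁ s hs U hU) hF₂ hβh₁ hβh₂' h0₁ h0₂ hβ₀ (hπ₁ s hs U hU) hπ₂
    hk (by linarith [hMnn]) (by linarith [hM₀]) hl0 hl1

end Summit.Ventures.CertifiedManyBodySolver.Observables

end
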